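import Mathlib
import Summits.ResolutionOfSingularities.ResolutionOfSingularities.Theorems.FrobeniusLadderFInjectiveMacaulayficationProp44PointStepRT
import Summits.ResolutionOfSingularities.ResolutionOfSingularities.Theorems.FrobeniusLadderFInjectiveMacaulayficationProp44CurveStepRT
import Literature.AlgebraicGeometry.Resolution.StrictTransformsStayTransverse
import Literature.AlgebraicGeometry.Resolution.StrictTransformTransverseCurve
import Literature.AlgebraicGeometry.Resolution.PermissibleCentres
import HarnessLib

/-!
# Route `RadicialJung`, crux `CleanModels` (stmt-ResolutionOfSingularities-15917), line `Sketch` rev 35, stub 6 `stub_cleanProp44` (X44c):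
# «NO BAD POINT» SURVIVES THE BLOWING UP OF A CLOSED POINT OF THE STRATUM — the first lemma the Phase II residual (R1ᵐⁱⁿ) needs

Seat decomp-res-hand-2 g17.  The research residual (R1ᵐⁱⁿ) of stub 6 (✓ `cleanProp44_of_phaseTwoMin_of_curveMinNoGamma`, hand-2 g17) lives at
no-bad stages (the curves of `Σ = {ord ≥ μ}` regular and pairwise transverse) where every intersecting curve needs L7b INSERTIONS — blowing ups of
CLOSED POINTS of the stratum (✓ `exists_isCleanPermissibleSeq_blowup_curve_of_base`) — before it may be blown up.  The first thing any attack on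
(R1ᵐⁱⁿ) must know is that such insertions do not destroy the no-bad property.  This is [CoP1] p. 10 («each exceptional curve in `Σ(i+1)` created by
the algorithm is regular … transverse to the strict transforms») read at a stage WITHOUT bad points, and it is assembled here from tree theorems only:

* the successor rule ✓ `CP2008Prop44.pointStep_next` (Lemma 4.3 (1) (3) (5): a curve of `Σ′` is the strict transform of a curve of `Σ`, or a regular
  line transverse to everything except strict transforms of curves SINGULAR at the centre — and there are none at a no-bad stage);
* the strict transform of a regular curve with a regular pair of parameters is regular (T2c, ✓ `vanishingIdeal_closure_eq_strictTransformIdeal_of_transverse`,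
  the centre `{x}` being trivially transverse to the curve);
* two strict transforms meeting over a transverse intersection point are transverse (✓ `stalkIdeal_strictTransform_sup_stalkIdeal_strictTransform_eq_maximalIdeal`).

* `pointStep_noBad` — **no bad point upstairs** after blowing up a closed point `x` of order `μ` and embedding dimension `3` at a stage without bad
  points (regular `X` of dimension `≤ 3`, `(J, μ)` with `ord ≤ μ`, `V(J)` of codimension `≥ 2`).  Twin of the tree's curve-centre version
  ✓ `CP2008Prop44.curveStep_noBad`; statement in the same currency (configurations `𝒞`, `𝒞′` given by membership equivalences).

Honest framing: OURS (bookkeeping over printed Lemma 4.3); nothing here proves X44c, any case of `CleanModels`, or resolution of singularities in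
characteristic `p`. [cite: CossartPiltant2008, Lemma 4.3 (1) (3) (5); Prop. 4.4 (proof, p. 10, steps 1–2)] [cite: StacksProject, Tag 0BI7, Tag 080E]
-/

noncomputable section

set_option linter.dupNamespace false -- mandated namespace of this single-conjunct summit

open CategoryTheory CategoryTheory.Limits AlgebraicGeometry TopologicalSpace IsLocalRing
open Literature.AlgebraicGeometry.Resolution
open Scheme.IdealSheafData
open Summit.ResolutionOfSingularities.ResolutionOfSingularities.Theorems.CP2008Prop44

namespace Summit.ResolutionOfSingularities.ResolutionOfSingularities.Theorems.RadicialJung.CleanModels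

set_option maxHeartbeats 1600000 in
-- configuration bookkeeping with long membership predicates
/-- **No bad point upstairs after the blowing up of a closed point of the stratum at a stage without bad points.**  `X` locally Noetherian regular of
dimension `≤ 3`, `(J, μ)` with `μ ≥ 1`, `ord ≤ μ`, `V(J)` of codimension `≥ 2`; `𝒞` the curves of `Σ = {ord ≥ μ}` (closures of its non-closed maximal
points), NO BAD POINT (every curve of `𝒞` regular, any two transverse where they meet); `x` a closed point with `ord_x J = μ` and embedding dimension `3`,
`π : X′ → X` the blowing up at `x`, `𝒞′` the curves of `Σ′` for the controlled transform.  Then `X′` has no bad point for `𝒞′`.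
[cite: CossartPiltant2008, Lemma 4.3 (1) (3) (5); Prop. 4.4 (proof, p. 10)] [cite: StacksProject, Tag 0BI7, Tag 080E] -/
theorem pointStep_noBad {X X' : Scheme.{0}} [IsLocallyNoetherian X] [IsLocallyNoetherian X'] (hX : Scheme.IsRegular X)
    (hX3 : topologicalKrullDim X ≤ 3) (J : X.IdealSheafData) {μ : ℕ} (hμ : 1 ≤ μ) (hle : ∀ z, idealOrder J z ≤ μ)
    (hcodim : ∀ z ∈ J.support, 1 < Order.coheight z)
    {𝒞 : Set (Closeds X)} (h𝒞 : ∀ C, C ∈ 𝒞 ↔ ∃ ζ ∈ maxPoints {z : X | (μ : ℕ∞) ≤ idealOrder J z},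
      ¬ IsClosed ({ζ} : Set X) ∧ C = ⟨closure {ζ}, isClosed_closure⟩)
    (hRT : ∀ y : X, ¬ ∃ C ∈ 𝒞,
      y ∈ (vanishingIdeal C).subschemeι '' (Scheme.regularLocus (vanishingIdeal C).subscheme)ᶜ ∨
      (y ∈ (C : Set X) ∧ ∃ C' ∈ 𝒞, C' ≠ C ∧ y ∈ (C' : Set X) ∧
        stalkIdeal (vanishingIdeal C) y ⊔ stalkIdeal (vanishingIdeal C') y ≠ maximalIdeal (X.presheaf.stalk y)))
    {x : X} (hx : IsClosed ({x} : Set X)) (hord : idealOrder J x = μ)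
    (hdim : (maximalIdeal (X.presheaf.stalk x)).spanFinrank = 3) {π : X' ⟶ X}
    (hπ : IsBlowup π (vanishingIdeal ⟨{x}, hx⟩))
    {𝒞' : Set (Closeds X')} (h𝒞' : ∀ C', C' ∈ 𝒞' ↔
      ∃ ζ ∈ maxPoints {z : X' | (μ : ℕ∞) ≤ idealOrder (controlledTransform π (vanishingIdeal ⟨{x}, hx⟩) J μ) z},
        ¬ IsClosed ({ζ} : Set X') ∧ C' = ⟨closure {ζ}, isClosed_closure⟩) :
    ∀ x' : X', ¬ ∃ C' ∈ 𝒞',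
      x' ∈ (vanishingIdeal C').subschemeι '' (Scheme.regularLocus (vanishingIdeal C').subscheme)ᶜ ∨
      (x' ∈ (C' : Set X') ∧ ∃ C'' ∈ 𝒞', C'' ≠ C' ∧ x' ∈ (C'' : Set X') ∧
        stalkIdeal (vanishingIdeal C') x' ⊔ stalkIdeal (vanishingIdeal C'') x' ≠ maximalIdeal (X'.presheaf.stalk x')) := by
  classical
  haveI hrx : IsRegularLocalRing (X.presheaf.stalk x) := hX x
  -- no curve of `𝒞` is singular anywhere; any two are transverse where they meet
  have hnosing : ∀ C ∈ 𝒞, ∀ y : X, y ∉ (vanishingIdeal C).subschemeι '' (Scheme.regularLocus (vanishingIdeal C).subscheme)ᶜ :=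
    fun C hC y hy => hRT y ⟨C, hC, Or.inl hy⟩
  have htrans : ∀ C ∈ 𝒞, ∀ D ∈ 𝒞, D ≠ C → ∀ y ∈ (C : Set X), y ∈ (D : Set X) →
      stalkIdeal (vanishingIdeal C) y ⊔ stalkIdeal (vanishingIdeal D) y = maximalIdeal (X.presheaf.stalk y) := by
    intro C hC D hD hDC y hyC hyD
    by_contra hne
    exact hRT y ⟨C, hC, Or.inr ⟨hyC, D, hD, hDC, hyD, hne⟩⟩
  -- T2c data of a curve of `𝒞` with respect to the point centre `{x}`
  have hCreg : ∀ C ∈ 𝒞, ∀ y ∈ (C : Set X), ∃ c : Fin 2 → X.presheaf.stalk y,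
      IsRsopPart c ∧ Ideal.span (Set.range c) = stalkIdeal (vanishingIdeal C) y := fun C hC y hy =>
    (curve_of_noBad hX hX3 J hμ hle hcodim h𝒞 hRT hC).2.2.2.1 y hy (hX y)
  have htrC : ∀ C : Closeds X, ∀ y ∈ (C : Set X) ∩ ((⟨{x}, hx⟩ : Closeds X) : Set X),
      stalkIdeal (vanishingIdeal C) y ⊔ stalkIdeal (vanishingIdeal (⟨{x}, hx⟩ : Closeds X)) y = maximalIdeal _ := by
    rintro C y ⟨hyC, hyx⟩
    have hyx' : y = x := hyx
    subst hyx'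
    rw [stalkIdeal_vanishingIdeal_singleton hx]
    exact sup_eq_right.mpr (stalkIdeal_vanishingIdeal_le_maximalIdeal C hyC)
  have hdimC : ∀ C : Closeds X, ∀ y ∈ (C : Set X) ∩ ((⟨{x}, hx⟩ : Closeds X) : Set X), ringKrullDim (X.presheaf.stalk y) = 3 := by
    rintro C y ⟨-, hyx⟩
    have hyx' : y = x := hyx
    subst hyx'
    have h := IsRegularLocalRing.spanFinrank_maximalIdeal (R := X.presheaf.stalk y)
    rw [hdim] at h
    exact_mod_cast h.symm
  -- a point of a strict transform maps into the curve
  have hmapsto : ∀ (C : Closeds X) {q : X'}, q ∈ closure (π ⁻¹' ((C : Set X) \ {x})) → π q ∈ (C : Set X) :=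
    fun C q hq => closure_minimal (Set.preimage_mono fun _ h => h.1) (C.isClosed.preimage π.continuous) hq
  -- the strict transform of a curve of `𝒞` is regular
  have hstreg : ∀ C ∈ 𝒞, Scheme.IsRegular (vanishingIdeal
      (⟨closure (π ⁻¹' ((C : Set X) \ {x})), isClosed_closure⟩ : Closeds X')).subscheme := by
    intro C hC
    obtain ⟨heq, hreg⟩ := vanishingIdeal_closure_eq_strictTransformIdeal_of_transverse hπ (hCreg C hC) (htrC C) (hdimC C)
    have heq' : vanishingIdeal (⟨closure (π ⁻¹' ((C : Set X) \ {x})), isClosed_closure⟩ : Closeds X') =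
        strictTransformIdeal π (vanishingIdeal (⟨{x}, hx⟩ : Closeds X)) (vanishingIdeal C) := heq
    rw [heq']
    exact hreg
  -- two strict transforms of curves of `𝒞` are transverse where they meet
  have hsttr : ∀ C ∈ 𝒞, ∀ D ∈ 𝒞, D ≠ C → ∀ q : X', q ∈ closure (π ⁻¹' ((C : Set X) \ {x})) →
      q ∈ closure (π ⁻¹' ((D : Set X) \ {x})) →
      stalkIdeal (vanishingIdeal (⟨closure (π ⁻¹' ((C : Set X) \ {x})), isClosed_closure⟩ : Closeds X')) q ⊔
        stalkIdeal (vanishingIdeal (⟨closure (π ⁻¹' ((D : Set X) \ {x})), isClosed_closure⟩ : Closeds X')) q =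
        maximalIdeal (X'.presheaf.stalk q) := by
    intro C hC D hD hDC q hqC hqD
    exact stalkIdeal_strictTransform_sup_stalkIdeal_strictTransform_eq_maximalIdeal hπ (hCreg C hC) (htrC C) (hdimC C) D hqC hqD
      (htrans C hC D hD hDC (π q) (hmapsto C hqC) (hmapsto D hqD))
  -- the successor rule (Lemma 4.3 via `pointStep_next`), with the «singular at the centre» exception void
  have hnext : ∀ C' ∈ 𝒞', (∃ C ∈ 𝒞, (C' : Set X') = closure (π ⁻¹' ((C : Set X) \ {x}))) ∨
      (Scheme.IsRegular (vanishingIdeal C').subscheme ∧ ∀ D ∈ 𝒞', D ≠ C' → ∀ q ∈ (C' : Set X') ∩ (D : Set X'),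
        stalkIdeal (vanishingIdeal C') q ⊔ stalkIdeal (vanishingIdeal D) q = maximalIdeal (X'.presheaf.stalk q)) := by
    intro C' hC'
    rcases pointStep_next hX hX3 J hμ hle hcodim hx hord hdim hπ h𝒞 h𝒞' C' hC' with h | ⟨hreg, htr⟩
    · exact Or.inl h
    · refine Or.inr ⟨hreg, fun D hD hDC' q hq => htr D hD hDC' ?_ q hq⟩
      rintro ⟨C, hC, -, hsing⟩
      exact hnosing C hC x hsing
  -- strict transforms as members of `Closeds X'`
  have hext : ∀ {C' : Closeds X'} {C : Closeds X}, (C' : Set X') = closure (π ⁻¹' ((C : Set X) \ {x})) →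
      C' = ⟨closure (π ⁻¹' ((C : Set X) \ {x})), isClosed_closure⟩ := fun h => Closeds.ext h
  -- MAIN: a bad point upstairs is absurd
  rintro x' ⟨C', hC', hbad⟩
  rcases hnext C' hC' with ⟨C, hC, hC'eq⟩ | ⟨hreg', htr'⟩
  · -- `C'` is the strict transform of the curve `C` of `𝒞`
    have hC'cl := hext hC'eq
    rcases hbad with hsing | ⟨hx'C', C'', hC'', hne, hx'C'', hntr⟩
    · rw [hC'cl] at hsing
      exact forall_not_mem_of_isRegular_subscheme _ (hstreg C hC) x' hsing
    · rcases hnext C'' hC'' with ⟨C₂, hC₂, hC''eq⟩ | ⟨-, htr''⟩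
      · -- both are strict transforms: transverse by persistence (the curves downstairs are transverse at `π x'`)
        have hC''cl := hext hC''eq
        have hC₂C : C₂ ≠ C := by
          rintro rfl
          exact hne (hC''cl.trans hC'cl.symm)
        have hq₁ : x' ∈ closure (π ⁻¹' ((C : Set X) \ {x})) := by rw [← hC'eq]; exact hx'C'
        have hq₂ : x' ∈ closure (π ⁻¹' ((C₂ : Set X) \ {x})) := by rw [← hC''eq]; exact hx'C''
        apply hntr
        rw [hC'cl, hC''cl]
        exact hsttr C hC C₂ hC₂ hC₂C x' hq₁ hq₂
      · -- `C''` is a new regular line: transverse to everything by the successor rule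
        apply hntr
        rw [sup_comm]
        exact htr'' C' hC' hne.symm x' ⟨hx'C'', hx'C'⟩
  · -- `C'` is a new regular line
    rcases hbad with hsing | ⟨hx'C', C'', hC'', hne, hx'C'', hntr⟩
    · exact forall_not_mem_of_isRegular_subscheme _ hreg' x' hsing
    · exact hntr (htr' C'' hC'' hne x' ⟨hx'C', hx'C''⟩)

end Summit.ResolutionOfSingularities.ResolutionOfSingularities.Theorems.RadicialJung.CleanModels

end
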